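import Summits.MatrixMultiplication.MatrixMultiplication.Theses.GLnSeparatingDesigns
import Literature.Computability.AlgebraicComplexity.BCGPUSeparatingPolynomials

/-!
# Disproof of `SeparationDegreeCost` — findings: NO KILL (crux-attack cycle 1; cdisprove cycle 2 — see §Cycle 2 at the end:
# fixed tolerance η ≥ 3/7 FALSE; binomial factor, degree bound, cross terms load-bearing; `2 ≤ s` junk-load-bearing)

Crux `stmt-MatrixMultiplication-18361` =
`Summit.MatrixMultiplication.MatrixMultiplication.Theses.GLnSeparatingDesigns.SeparationDegreeCost`
(BCGPU 2024 Cor. 2.8 with its border clause, typed for `η`-approximate separators).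
Seat `refuter-rattack-stmt-MatrixMultiplication-18361-0`, 2026-08-17. Everything below is
sorry-free and `lean check`ed (rc 0).

Findings (all attacks FAILED to kill; the crux is, on paper, a theorem — see NOTES):
* `crux_iff` — the crux is literally `∀ n ≥ 3, ∀ s ≥ 2, ∀ N, DesignHyp → CostConclusion`.
* (A) non-vacuity: `designHyp_one` — the hypothesis holds at `n = 3, s = 2, N = (1,1,1)`
  (`X = Y = Z = {1}`, `p = 1`); the conclusion there is `1 ≤ 2^{3(ω−2)}·55`, true.
* (a) LOAD-BEARING: `separationDegreeCost_false_without_designs` — with the design hypothesis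
  dropped the statement is false (`n = 3, s = 2, N = 100`: `100^ω ≥ 10^4 > 8·55 ≥ RHS`, using only
  `2 ≤ ω ≤ 3`). Any proof must use the designs.
* (a') NOT load-bearing: `designHyp_iff_withoutTPP` — the TPP clause of the hypothesis is implied by
  the separation clause at any tolerance `η < 1/2` (`tpp_of_approxSeparating`, any group), so the
  crux with the TPP clause deleted is EQUIVALENT to the crux (`separationDegreeCost_iff_withoutTPP`).
* (d) direction of the print gap: `cor_2_8_of_separationDegreeCost` — the crux implies the vendored
  exact fact `Literature.Computability.AlgebraicComplexity.BCGPU2024_cor_2_8` (fixed designs, exact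
  Def. 2.1 separators); the converse is the real content (Euclidean = Zariski closure of the
  constructible restriction set of `⊕_λ ⟨d_λ⟩` ⇒ degeneration ⇒ border pricing), not attempted here.
* (c) natural strengthenings (paper only, NOTES.md §strengthenings): the additive factor
  `C(s+n²,n²)` cannot be dropped (n = 3, s = 2, X = Y = {1}, Z = 43 weight-≤2 0/1-perturbations of
  `I`, exactly 2-separated: `43^{ω/3} ≥ 43^{2/3} > 8 ≥ 2^{3(ω−2)}`); dropping `s^{C(n,2)(ω−2)}`
  is not refutable in the tree (it would need `ω > 2`).
-/

open Summit.MatrixMultiplication.MatrixMultiplication.Theses.GLnSeparatingDesigns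
open Literature.Computability.AlgebraicComplexity

set_option linter.dupNamespace false

noncomputable section

namespace Summit.MatrixMultiplication.MatrixMultiplication.Cruxes.SeparationDegreeCost.Disproof

/-- The design hypothesis of `SeparationDegreeCost`, as a predicate in `n, s, N₁, N₂, N₃`
(copied verbatim from the route decl). -/
def DesignHyp (n s N₁ N₂ N₃ : ℕ) : Prop :=
  ∀ η : ℝ, 0 < η → ∃ X Y Z : Finset (Matrix.GeneralLinearGroup (Fin n) ℂ), N₁ ≤ X.card ∧ N₂ ≤ Y.card ∧ N₃ ≤ Z.card ∧ (∀ x ∈ X, ∀ x' ∈ X, ∀ y ∈ Y, ∀ y' ∈ Y, ∀ z ∈ Z, ∀ z' ∈ Z, x * y⁻¹ * y' * z⁻¹ = x' * z'⁻¹ → x = x' ∧ y = y' ∧ z = z') ∧ ∀ x₀ ∈ X, ∀ z₀ ∈ Z, ∃ p : MvPolynomial (Fin n × Fin n) ℂ, p.totalDegree ≤ s ∧ ∀ x ∈ X, ∀ y ∈ Y, ∀ y' ∈ Y, ∀ z ∈ Z, ((x = x₀ ∧ y = y' ∧ z = z₀) → ‖MvPolynomial.eval (fun ij : Fin n × Fin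 n => ((x * y⁻¹ * y' * z⁻¹ : Matrix.GeneralLinearGroup (Fin n) ℂ) : Matrix (Fin n) (Fin n) ℂ) ij.1 ij.2) p - 1‖ ≤ η) ∧ (¬ (x = x₀ ∧ y = y' ∧ z = z₀) → ‖MvPolynomial.eval (fun ij : Fin n × Fin n => ((x * y⁻¹ * y' * z⁻¹ : Matrix.GeneralLinearGroup (Fin n) ℂ) : Matrix (Fin n) (Fin n) ℂ) ij.1 ij.2) p‖ ≤ η)

/-- The conclusion of `SeparationDegreeCost`. -/
def CostConclusion (n s N₁ N₂ N₃ : ℕ) : Prop :=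
  ((N₁ : ℝ) * N₂ * N₃) ^ (omega ℂ / 3) ≤ (s : ℝ) ^ ((n : ℝ) * (n - 1) / 2 * (omega ℂ - 2)) * ((s + n ^ 2).choose (n ^ 2) : ℝ)

/-- Sanity: the crux is literally `∀ n ≥ 3, ∀ s ≥ 2, ∀ N, DesignHyp → CostConclusion`. -/
theorem crux_iff :
    SeparationDegreeCost ↔
      ∀ n : ℕ, 3 ≤ n → ∀ s : ℕ, 2 ≤ s → ∀ N₁ N₂ N₃ : ℕ,
        DesignHyp n s N₁ N₂ N₃ → CostConclusion n s N₁ N₂ N₃ :=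
  Iff.rfl

/-! ## (A) Non-vacuity: the hypothesis holds at `n = 3, s = 2, N = (1,1,1)`. -/

/-- Witness `X = Y = Z = {1}`, `p = 1` (degree 0). -/
theorem designHyp_one : DesignHyp 3 2 1 1 1 := by
  intro η hη
  refine ⟨{1}, {1}, {1}, by simp, by simp, by simp, ?_, ?_⟩
  · intro x hx x' hx' y hy y' hy' z hz z' hz' _
    simp only [Finset.mem_singleton] at hx hx' hy hy' hz hz'
    subst hx hx' hy hy' hz hz'
    exact ⟨rfl, rfl, rfl⟩
  · intro x₀ hx₀ z₀ hz₀
    refine ⟨1, by simp, ?_⟩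
    intro x hx y hy y' hy' z hz
    simp only [Finset.mem_singleton] at hx hx₀ hy hy' hz hz₀
    subst hx hx₀ hy hy' hz hz₀
    refine ⟨fun _ => ?_, fun h => (h ⟨rfl, rfl, rfl⟩).elim⟩
    simp [hη.le]

/-! ## (a) Load-bearing: the bare conclusion fails at `n = 3, s = 2, N = 100`. -/

theorem costConclusion_false : ¬ CostConclusion 3 2 100 100 100 := by
  unfold CostConclusion
  intro h
  have hω2 : (2 : ℝ) ≤ omega ℂ := omega_two_le ℂ
  have hω3 : omega ℂ ≤ 3 := omega_le_three' ℂ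
  -- LHS = 100 ^ ω ≥ 100 ^ 2
  have hL : ((100 : ℕ) : ℝ) * (100 : ℕ) * (100 : ℕ) = (100 : ℝ) ^ (3 : ℝ) := by norm_num
  rw [hL, ← Real.rpow_mul (by norm_num : (0 : ℝ) ≤ 100)] at h
  have e : (3 : ℝ) * (omega ℂ / 3) = omega ℂ := by ring
  rw [e] at h
  have h1 : (100 : ℝ) ^ (2 : ℝ) ≤ (100 : ℝ) ^ omega ℂ :=
    Real.rpow_le_rpow_of_exponent_le (by norm_num) hω2
  have h2 : (100 : ℝ) ^ (2 : ℝ) = 10000 := by norm_num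
  -- RHS ≤ 2^3 * 55
  have h3 : ((2 : ℕ) : ℝ) ^ (((3 : ℕ) : ℝ) * ((3 : ℕ) - 1) / 2 * (omega ℂ - 2)) ≤ (2 : ℝ) ^ (3 : ℝ) := by
    push_cast
    exact Real.rpow_le_rpow_of_exponent_le (by norm_num) (by nlinarith)
  have h4 : (2 : ℝ) ^ (3 : ℝ) = 8 := by norm_num
  have h5 : (((2 : ℕ) + 3 ^ 2).choose (3 ^ 2) : ℝ) = 55 := by norm_num [Nat.choose]
  rw [h5] at h
  nlinarith [h, h1, h2, h3, h4]

/-- The crux with the design hypothesis DROPPED. -/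
def SeparationDegreeCostWithoutDesigns : Prop :=
  ∀ n : ℕ, 3 ≤ n → ∀ s : ℕ, 2 ≤ s → ∀ N₁ N₂ N₃ : ℕ, CostConclusion n s N₁ N₂ N₃

/-- Any proof of the crux must use the design hypothesis. -/
theorem separationDegreeCost_false_without_designs : ¬ SeparationDegreeCostWithoutDesigns :=
  fun h => costConclusion_false (h 3 (by norm_num) 2 le_rfl 100 100 100)

/-! ## (a') The TPP clause is NOT load-bearing: it is implied by the separation clause. -/

/-- Abstract form: in any group, `η`-approximate separating functions with `η < 1/2`
force the TPP in embedding form. (In the crux, `f x₀ z₀ g = eval (entries of g) p`.) -/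
theorem tpp_of_approxSeparating {G : Type*} [Group G] (X Y Z : Finset G) (f : G → G → G → ℂ)
    {η : ℝ} (hη : η < 1 / 2)
    (hsep : ∀ x₀ ∈ X, ∀ z₀ ∈ Z, ∀ x ∈ X, ∀ y ∈ Y, ∀ y' ∈ Y, ∀ z ∈ Z,
      ((x = x₀ ∧ y = y' ∧ z = z₀) → ‖f x₀ z₀ (x * y⁻¹ * y' * z⁻¹) - 1‖ ≤ η) ∧
      (¬ (x = x₀ ∧ y = y' ∧ z = z₀) → ‖f x₀ z₀ (x * y⁻¹ * y' * z⁻¹)‖ ≤ η)) :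
    ∀ x ∈ X, ∀ x' ∈ X, ∀ y ∈ Y, ∀ y' ∈ Y, ∀ z ∈ Z, ∀ z' ∈ Z,
      x * y⁻¹ * y' * z⁻¹ = x' * z'⁻¹ → x = x' ∧ y = y' ∧ z = z' := by
  intro x hx x' hx' y hy y' hy' z hz z' hz' hQ
  by_contra hne
  -- value ≈ 1 at the tuple (x', y, y, z'), whose product is x' z'⁻¹
  have h1 := (hsep x' hx' z' hz' x' hx' y hy y hy z' hz').1 ⟨rfl, rfl, rfl⟩
  have e1 : x' * y⁻¹ * y * z'⁻¹ = x' * z'⁻¹ := by group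
  rw [e1] at h1
  -- value ≈ 0 at the tuple (x, y, y', z), whose product is also x' z'⁻¹
  have h0 := (hsep x' hx' z' hz' x hx y hy y' hy' z hz).2 hne
  rw [hQ] at h0
  have : (1 : ℝ) ≤ ‖f x' z' (x' * z'⁻¹) - 1‖ + ‖f x' z' (x' * z'⁻¹)‖ := by
    calc (1 : ℝ) = ‖(1 : ℂ)‖ := by simp
      _ = ‖f x' z' (x' * z'⁻¹) - (f x' z' (x' * z'⁻¹) - 1)‖ := by ring_nf
      _ ≤ ‖f x' z' (x' * z'⁻¹)‖ + ‖f x' z' (x' * z'⁻¹) - 1‖ := norm_sub_le _ _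
      _ = _ := add_comm _ _
  linarith

/-- The design hypothesis with the TPP clause DROPPED. -/
def DesignHypNoTPP (n s N₁ N₂ N₃ : ℕ) : Prop :=
  ∀ η : ℝ, 0 < η → ∃ X Y Z : Finset (Matrix.GeneralLinearGroup (Fin n) ℂ), N₁ ≤ X.card ∧ N₂ ≤ Y.card ∧ N₃ ≤ Z.card ∧ ∀ x₀ ∈ X, ∀ z₀ ∈ Z, ∃ p : MvPolynomial (Fin n × Fin n) ℂ, p.totalDegree ≤ s ∧ ∀ x ∈ X, ∀ y ∈ Y, ∀ y' ∈ Y, ∀ z ∈ Z, ((x = x₀ ∧ y = y' ∧ z = z₀) → ‖MvPolynomial.eval (fun ij : Fin n × Fin n => ((x * y⁻¹ * y' * z⁻¹ : Matrix.GeneralLinearGroup (Fin n) ℂ) : Matrix (Fin n) (Fin n) ℂ) ij.1 ij.2) p - 1‖ ≤ η) ∧ (¬ (x = x₀ ∧ y = y' ∧ z = z₀) → ‖MvPolynomial.eval (fun ij : Fin n × Fin n => ((x * y⁻¹ * y' * z⁻¹ : Matrix.GeneralLinearGroup (Fin n) ℂ) : Matrix (Fin n) (Fin n) ℂ) ij.1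 ij.2) p‖ ≤ η)

/-- Dropping the TPP clause does not weaken the hypothesis: at every `η < 1/2` it comes for free,
and for `η ≥ 1/2` one may use the design for tolerance `min η (1/4)`. -/
theorem designHyp_iff_noTPP (n s N₁ N₂ N₃ : ℕ) :
    DesignHyp n s N₁ N₂ N₃ ↔ DesignHypNoTPP n s N₁ N₂ N₃ := by
  constructor
  · intro h η hη
    obtain ⟨X, Y, Z, hX, hY, hZ, -, hsep⟩ := h η hη
    exact ⟨X, Y, Z, hX, hY, hZ, hsep⟩
  · intro h η hη
    obtain ⟨X, Y, Z, hX, hY, hZ, hsep⟩ := h (min η (1 / 4)) (lt_min hη (by norm_num))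
    refine ⟨X, Y, Z, hX, hY, hZ, ?_, ?_⟩
    · classical
      choose p hp using hsep
      refine tpp_of_approxSeparating X Y Z
        (fun x₀ z₀ g => if hx : x₀ ∈ X then if hz : z₀ ∈ Z then
          MvPolynomial.eval (fun ij : Fin n × Fin n => ((g : Matrix.GeneralLinearGroup (Fin n) ℂ) : Matrix (Fin n) (Fin n) ℂ) ij.1 ij.2) (p x₀ hx z₀ hz) else 0 else 0)
        (η := min η (1 / 4)) (lt_of_le_of_lt (min_le_right _ _) (by norm_num)) ?_
      intro x₀ hx₀ z₀ hz₀ x hx y hy y' hy' z hz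
      simp only [hx₀, hz₀, dite_true]
      exact (hp x₀ hx₀ z₀ hz₀).2 x hx y hy y' hy' z hz
    · intro x₀ hx₀ z₀ hz₀
      obtain ⟨p, hp, hsep'⟩ := hsep x₀ hx₀ z₀ hz₀
      refine ⟨p, hp, fun x hx y hy y' hy' z hz => ?_⟩
      obtain ⟨h1, h0⟩ := hsep' x hx y hy y' hy' z hz
      exact ⟨fun hh => (h1 hh).trans (min_le_left _ _), fun hh => (h0 hh).trans (min_le_left _ _)⟩

/-- The crux with the TPP clause deleted from its hypothesis. -/
def SeparationDegreeCostWithoutTPP : Prop :=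
  ∀ n : ℕ, 3 ≤ n → ∀ s : ℕ, 2 ≤ s → ∀ N₁ N₂ N₃ : ℕ,
    DesignHypNoTPP n s N₁ N₂ N₃ → CostConclusion n s N₁ N₂ N₃

/-- Mutation finding: deleting the TPP clause gives an EQUIVALENT statement (so no
`_false_without_TPP` exists; the clause is harmless decoration for the prover). -/
theorem separationDegreeCost_iff_withoutTPP :
    SeparationDegreeCost ↔ SeparationDegreeCostWithoutTPP := by
  rw [crux_iff]
  refine forall₂_congr fun n _ => forall₂_congr fun s _ => ?_
  refine forall₃_congr fun N₁ N₂ N₃ => ?_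
  rw [designHyp_iff_noTPP]

/-! ## (d) The crux implies the vendored exact print (BCGPU 2024 Cor. 2.8, `BCGPU2024_cor_2_8`). -/

/-- `SeparationDegreeCost` (η-approximate, η-dependent designs) ⟹ the exact Cor. 2.8 as vendored:
fixed TPP designs with exact Def. 2.1 separators of degree `≤ s` satisfy the `η`-hypothesis for
every `η > 0`. (The converse — the closure/degeneration step — is the crux's real content.) -/
theorem cor_2_8_of_separationDegreeCost (h : SeparationDegreeCost) : BCGPU2024_cor_2_8 := by
  intro n hn s hs X Y Z htpp hf
  obtain ⟨f, hf, hpoly⟩ := hf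
  refine h n hn s hs X.card Y.card Z.card ?_
  intro η hη
  refine ⟨X, Y, Z, le_rfl, le_rfl, le_rfl, htpp, ?_⟩
  intro x₀ hx₀ z₀ hz₀
  obtain ⟨p, hp, hpf⟩ := hpoly x₀ hx₀ z₀ hz₀
  refine ⟨p, hp, fun x hx y hy y' hy' z hz => ⟨fun hxyz => ?_, fun hxyz => ?_⟩⟩
  · obtain ⟨rfl, rfl, rfl⟩ := hxyz
    have e : x * y⁻¹ * y * z⁻¹ = x * z⁻¹ := by group
    rw [← hpf, e, (hf x hx z hz).1]
    simp [hη.le]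
  · have hne : x * y⁻¹ * y' * z⁻¹ ≠ x₀ * z₀⁻¹ := fun heq =>
      hxyz (htpp x hx x₀ hx₀ y hy y' hy' z hz z₀ hz₀ heq)
    rw [← hpf, (hf x₀ hx₀ z₀ hz₀).2 x hx y hy y' hy' z hz hne]
    simp [hη.le]


/-! # Cycle 2 additions (seat `refuter-cdisprove-stmt-MatrixMultiplication-18361-0`, 2026-08-17):
fixed tolerance, the binomial factor, the clause `2 ≤ s`

Mirrors the (now LANDED) Negative-lane files
`Theorems/SeparationDegreeCost/Negative/FixedTolerance.lean` and
`Theorems/SeparationDegreeCost/Negative/BinomialAndDegreeClauses.lean`,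
`Theorems/SeparationDegreeCost/Negative/DegreeBoundAndCrossTerms.lean`
(namespace `Summit.MatrixMultiplication.MatrixMultiplication.Theorems.SeparationDegreeCostNeg`), inlined in
the sub-namespace `Neg` until they land; import those files instead once accepted.  All sorry-free,
kernel-only (`decide`, no `native_decide`), axioms `propext, Classical.choice, Quot.sound`.

* `Neg.separationDegreeCost_fixedTol_false` — the `∀ η > 0` (limit) is LOAD-BEARING: asking for a design
  at ONE tolerance `η ≥ 3/7` does not price (576-point design in `GL₃`, quadratic separators, `576 > 8³`).
  (LP, job j023880: the best degree-`≤ 2` sup-tolerance on this 576-point family is `57/149 ≈ 0.3826`,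
  rank of the quadratic evaluation map `54`; affine separators only reach `3/4`. So `3/7` is near what
  this family can give; smaller `η` needs other designs — conjecturally spherical codes, `s ≈ n²`.)
* `Neg.separationDegreeCost_noBinomial_false` — the factor `C(s+n²,n²)` cannot be dropped (33 exactly
  2-separated points `I + E`; `33^{2/3} > 8`), the Lean version of cycle 1's paper claim (c).
* `Neg.omega_eq_two_of_separationDegreeCost_anyDegree` — deleting `2 ≤ s` makes the crux imply
  `ω = 2` through `0^0 = 1` (`s = 0`, trivial design): the `rpow` base `s ≥ 1` is used by any proof.
* `Neg.separationDegreeCost_noDegreeBound_false` — the degree bound is load-bearing: the same 576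
  points are EXACTLY separated in degree 575 (`lagrange576`), contrast `3/7` in degree 2.
* `Neg.separationDegreeCost_noCross_false` — the cross terms `y ≠ y'` are load-bearing (without them
  `X = Z = {1}`, `Y` = 576 points, `p = 1` is a design and `N₂` is unbounded).
(ALL LANDED: `Negative/FixedTolerance.lean` p147053, `Negative/BinomialAndDegreeClauses.lean` p147439,
`Negative/DegreeBoundAndCrossTerms.lean` p147440 — import
`Summits.MatrixMultiplication.MatrixMultiplication.Theorems.SeparationDegreeCost.Negative.*`; the strengthened
statements are written out inline there, since a parameterless `def … : Prop` in Theorems/ is relocated to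
Literature/ as a named fact — p147373/p147375 bounced so.  This `Neg` namespace is now a redundant mirror.)
WHY THE CRUX STILL RESISTS: every attack that keeps the hypothesis "for EVERY η > 0" must beat
`(N₁N₂N₃)^{2/3} ≤ C(s+n²,n²)` (the claim at `ω = 2`, which no argument inside the tree can exclude),
and that inequality is a flattening-rank consequence of the degeneration `⟨N₁,N₂,N₃⟩ ⊴ ⊕_λ⟨d_λ⟩`
(`Σ d_λ² = C(s+n²,n²)`); exact / arbitrarily fine separation of `N` points by `Pol_{≤ s}` forces
`N ≤ dim Pol_{≤ s} = C(s+n²,n²)`.  Only a misrendering could be refuted, and the rendering was audited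
clean (cycle 1 + grounder): the crux is a theorem to vendor (border CU pricing via constructible closure).
-/

namespace Neg

/-! ## The crux, sliced by tolerance -/

/-- The design clause of the crux at ONE tolerance `η` (verbatim body of its hypothesis). [folklore] -/
def DesignAt (n s N₁ N₂ N₃ : ℕ) (η : ℝ) : Prop :=
  ∃ X Y Z : Finset (Matrix.GeneralLinearGroup (Fin n) ℂ), N₁ ≤ X.card ∧ N₂ ≤ Y.card ∧ N₃ ≤ Z.card ∧ (∀ x ∈ X, ∀ x' ∈ X, ∀ y ∈ Y, ∀ y' ∈ Y, ∀ z ∈ Z, ∀ z' ∈ Z, x * y⁻¹ * y' * z⁻¹ = x' * z'⁻¹ → x = x' ∧ y = y' ∧ z = z') ∧ ∀ x₀ ∈ X, ∀ z₀ ∈ Z, ∃ p : MvPolynomial (Fin n × Fin n) ℂ, p.totalDegree ≤ s ∧ ∀ x ∈ X, ∀ y ∈ Y, ∀ y' ∈ Y, ∀ z ∈ Z, ((x = x₀ ∧ y = y' ∧ z = z₀) → ‖MvPolynomial.eval (fun ij : Fin n × Fin n => ((x * y⁻¹ * y' * z⁻¹ : Matrix.GeneralLinearGroup (Fin n) ℂ)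 : Matrix (Fin n) (Fin n) ℂ) ij.1 ij.2) p - 1‖ ≤ η) ∧ (¬ (x = x₀ ∧ y = y' ∧ z = z₀) → ‖MvPolynomial.eval (fun ij : Fin n × Fin n => ((x * y⁻¹ * y' * z⁻¹ : Matrix.GeneralLinearGroup (Fin n) ℂ) : Matrix (Fin n) (Fin n) ℂ) ij.1 ij.2) p‖ ≤ η)

/-- The conclusion of the crux. [folklore] -/
def Conclusion (n s N₁ N₂ N₃ : ℕ) : Prop :=
  ((N₁ : ℝ) * N₂ * N₃) ^ (omega ℂ / 3) ≤
    (s : ℝ) ^ ((n : ℝ) * (n - 1) / 2 * (omega ℂ - 2)) * ((s + n ^ 2).choose (n ^ 2) : ℝ)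

/-- The crux is literally `∀ n ≥ 3, ∀ s ≥ 2, ∀ N, (∀ η > 0, DesignAt …) → Conclusion …`. [folklore] -/
theorem separationDegreeCost_iff :
    SeparationDegreeCost ↔ ∀ n : ℕ, 3 ≤ n → ∀ s : ℕ, 2 ≤ s → ∀ N₁ N₂ N₃ : ℕ,
      (∀ η : ℝ, 0 < η → DesignAt n s N₁ N₂ N₃ η) → Conclusion n s N₁ N₂ N₃ :=
  Iff.rfl

/-- `X`-only designs: with `Y = Z = {1}` the TPP is automatic and a separator for the target `x₀`
is a polynomial that is `≈ 1` at `x₀` and `≈ 0` on `X ∖ {x₀}`. [folklore] -/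
theorem designAt_of_points {n s : ℕ} {η : ℝ} (X : Finset (Matrix.GeneralLinearGroup (Fin n) ℂ))
    (hsep : ∀ x₀ ∈ X, ∃ p : MvPolynomial (Fin n × Fin n) ℂ, p.totalDegree ≤ s ∧ ∀ x ∈ X,
      (x = x₀ → ‖MvPolynomial.eval (fun ij : Fin n × Fin n =>
        ((x : Matrix.GeneralLinearGroup (Fin n) ℂ) : Matrix (Fin n) (Fin n) ℂ) ij.1 ij.2) p - 1‖ ≤ η) ∧
      (x ≠ x₀ → ‖MvPolynomial.eval (fun ij : Fin n × Fin n =>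
        ((x : Matrix.GeneralLinearGroup (Fin n) ℂ) : Matrix (Fin n) (Fin n) ℂ) ij.1 ij.2) p‖ ≤ η)) :
    DesignAt n s X.card 1 1 η := by
  refine ⟨X, {1}, {1}, le_rfl, by simp, by simp, ?_, ?_⟩
  · intro x _ x' _ y hy y' hy' z hz z' hz' h
    simp only [Finset.mem_singleton] at hy hy' hz hz'
    subst hy hy' hz hz'
    simpa using h
  · intro x₀ hx₀ z₀ hz₀
    simp only [Finset.mem_singleton] at hz₀
    subst hz₀
    obtain ⟨p, hp, hsep⟩ := hsep x₀ hx₀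
    refine ⟨p, hp, ?_⟩
    intro x hx y hy y' hy' z hz
    simp only [Finset.mem_singleton] at hy hy' hz
    subst hy hy' hz
    simp only [inv_one, mul_one, and_true]
    exact hsep x hx

/-- The trivial design `X = Y = Z = {1}`, `p = 1`, at every `s` and every `η ≥ 0`. [folklore] -/
theorem designAt_one (n s : ℕ) {η : ℝ} (hη : 0 ≤ η) : DesignAt n s 1 1 1 η := by
  have h := designAt_of_points (n := n) (s := s) (η := η) {1} (fun x₀ hx₀ => ⟨1, by simp, ?_⟩)
  · simpa using h
  · intro x hx
    simp only [Finset.mem_singleton] at hx hx₀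
    subst hx hx₀
    exact ⟨fun _ => by simp [hη], fun h => (h rfl).elim⟩

/-! ## Integer `3 × 3` matrices as elements of `GL₃(ℂ)` -/

/-- Explicit `3 × 3` determinant (computable, for `decide`). [folklore] -/
def det3 (M : Fin 3 → Fin 3 → ℤ) : ℤ :=
  M 0 0 * (M 1 1 * M 2 2 - M 1 2 * M 2 1) - M 0 1 * (M 1 0 * M 2 2 - M 1 2 * M 2 0)
    + M 0 2 * (M 1 0 * M 2 1 - M 1 1 * M 2 0)

/-- An integer matrix viewed over `ℂ`. [folklore] -/
def castM (A : Fin 3 → Fin 3 → ℤ) : Matrix (Fin 3) (Fin 3) ℂ := Matrix.of fun i j => (A i j : ℂ)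

/-- The determinant commutes with the cast `ℤ → ℂ` (via the explicit `3 × 3` formula). [folklore] -/
theorem det_castM (A : Fin 3 → Fin 3 → ℤ) : (castM A).det = (det3 A : ℂ) := by
  simp only [Matrix.det_fin_three, castM, Matrix.of_apply, det3]
  push_cast
  ring

/-- Total map to `GL₃(ℂ)` (junk value `1` on singular matrices). [folklore] -/
noncomputable def toGL (A : Fin 3 → Fin 3 → ℤ) : Matrix.GeneralLinearGroup (Fin 3) ℂ :=
  if h : det3 A = 0 then 1 else
    Matrix.GeneralLinearGroup.mkOfDetNeZero (castM A) (by rw [det_castM]; exact_mod_cast h)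

/-- On invertible input `toGL A` is the matrix `A` itself. [folklore] -/
theorem val_toGL {A : Fin 3 → Fin 3 → ℤ} (h : det3 A ≠ 0) :
    ((toGL A : Matrix.GeneralLinearGroup (Fin 3) ℂ) : Matrix (Fin 3) (Fin 3) ℂ) = castM A := by
  simp only [toGL, dif_neg h, Matrix.GeneralLinearGroup.val_mkOfDetNeZero]

/-- `toGL` is injective on invertible integer matrices. [folklore] -/
theorem toGL_inj {A B : Fin 3 → Fin 3 → ℤ} (hA : det3 A ≠ 0) (hB : det3 B ≠ 0)
    (h : toGL A = toGL B) : A = B := by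
  have h' := congrArg (fun g : Matrix.GeneralLinearGroup (Fin 3) ℂ => (g : Matrix (Fin 3) (Fin 3) ℂ)) h
  simp only [val_toGL hA, val_toGL hB] at h'
  funext i j
  have hij := congrFun (congrFun h' i) j
  simpa [castM] using hij

/-- Frobenius product and squared norm over `ℤ`. [folklore] -/
def ip (A B : Fin 3 → Fin 3 → ℤ) : ℤ := ∑ i, ∑ j, A i j * B i j

/-- The linear form `g ↦ ⟨A, g⟩` as a polynomial in the nine entries. [folklore] -/
noncomputable def lin (A : Fin 3 → Fin 3 → ℤ) : MvPolynomial (Fin 3 × Fin 3) ℂ :=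
  ∑ i, ∑ j, MvPolynomial.C (A i j : ℂ) * MvPolynomial.X (i, j)

/-- The linear form has total degree `≤ 1`. [folklore] -/
theorem totalDegree_lin (A : Fin 3 → Fin 3 → ℤ) : (lin A).totalDegree ≤ 1 := by
  unfold lin
  refine (MvPolynomial.totalDegree_finsetSum _ _).trans (Finset.sup_le fun i _ => ?_)
  refine (MvPolynomial.totalDegree_finsetSum _ _).trans (Finset.sup_le fun j _ => ?_)
  refine (MvPolynomial.totalDegree_mul _ _).trans ?_
  rw [MvPolynomial.totalDegree_C, MvPolynomial.totalDegree_X, zero_add]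

/-- Evaluating the linear form of `A` at the integer point `B` gives `⟨A, B⟩`. [folklore] -/
theorem eval_lin (A B : Fin 3 → Fin 3 → ℤ) :
    MvPolynomial.eval (fun ij : Fin 3 × Fin 3 => castM B ij.1 ij.2) (lin A) = (ip A B : ℂ) := by
  simp [lin, ip, castM, map_sum, MvPolynomial.eval_X]

/-! ## Fixed tolerance: the 576-point design -/

/-- Parameters `((t, m, i, b), (ε₀, ε₁, ε₂, e))` of the design: the permutation `σ : r ↦ t ∓ r` of
`Fin 3`, the row `i` carrying the fourth entry, which of the two free columns of row `i` it occupies,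
and the four signs; `3·2·3·2·2⁴ = 576`.  (Grouped as a pair of quadruples: instance synthesis for
longer flat products fails.) [folklore] -/
abbrev Param := (Fin 3 × Bool × Fin 3 × Bool) × (Bool × Bool × Bool × Bool)

/-- `±1` from a Boolean. [folklore] -/
def sgnZ (x : Bool) : ℤ := if x then 1 else -1

/-- The six permutations of `Fin 3`: `r ↦ t - r` (`m = true`) or `r ↦ t + r`. [folklore] -/
def perm3 (t : Fin 3) (m : Bool) (r : Fin 3) : Fin 3 := if m then t - r else t + r

/-- Sign selector for the three rows. [folklore] -/
def sel (ε₀ ε₁ ε₂ : Bool) (r : Fin 3) : Bool := if r = 0 then ε₀ else if r = 1 then ε₁ else ε₂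

/-- The design matrix `Σ_r ±E_{r, σ r} ± E_{i, τ}` with `τ = σ i + 1` (`b = true`) or `σ i + 2`:
entries in `{0, ±1}`, exactly four of them non-zero, determinant `±1`. [folklore] -/
def design576 (p : Param) : Fin 3 → Fin 3 → ℤ :=
  match p with
  | ((t, m, i, b), (ε₀, ε₁, ε₂, e)) => fun r c =>
    (if c = perm3 t m r then sgnZ (sel ε₀ ε₁ ε₂ r) else 0) +
      (if r = i ∧ c = perm3 t m r + (if b then 1 else 2) then sgnZ e else 0)

/-- First non-zero column of row `r`. [folklore] -/
def colOf (A : Fin 3 → Fin 3 → ℤ) (r : Fin 3) : Fin 3 :=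
  if A r 0 ≠ 0 then 0 else if A r 1 ≠ 0 then 1 else 2

/-- Number of non-zero entries of row `r`. [folklore] -/
def nzCount (A : Fin 3 → Fin 3 → ℤ) (r : Fin 3) : ℕ :=
  (if A r 0 ≠ 0 then 1 else 0) + (if A r 1 ≠ 0 then 1 else 0) + (if A r 2 ≠ 0 then 1 else 0)

/-- The row with two non-zero entries. [folklore] -/
def twoRow (A : Fin 3 → Fin 3 → ℤ) : Fin 3 :=
  if nzCount A 0 = 2 then 0 else if nzCount A 1 = 2 then 1 else 2

/-- The permutation `σ` read off a design matrix. [folklore] -/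
def permOf (A : Fin 3 → Fin 3 → ℤ) (r : Fin 3) : Fin 3 :=
  if r = twoRow A then -(colOf A (twoRow A + 1) + colOf A (twoRow A + 2)) else colOf A r

/-- The extra column `τ` read off a design matrix. [folklore] -/
def otherCol (A : Fin 3 → Fin 3 → ℤ) : Fin 3 :=
  if (0 : Fin 3) ≠ permOf A (twoRow A) ∧ A (twoRow A) 0 ≠ 0 then 0
  else if (1 : Fin 3) ≠ permOf A (twoRow A) ∧ A (twoRow A) 1 ≠ 0 then 1 else 2

/-- Left inverse of `design576` (so that injectivity is a `decide` over the 576 parameters). [folklore] -/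
def param576 (A : Fin 3 → Fin 3 → ℤ) : Param :=
  ((permOf A 0, decide (permOf A 1 = permOf A 0 - 1), twoRow A,
      decide (otherCol A = permOf A (twoRow A) + 1)),
    (decide (A 0 (permOf A 0) = 1), decide (A 1 (permOf A 1) = 1), decide (A 2 (permOf A 2) = 1),
      decide (A (twoRow A) (otherCol A) = 1)))

set_option maxRecDepth 16384 in
/-- `param576` is a left inverse of `design576` (checked on all 576 parameters). [folklore] -/
theorem param576_design576 : ∀ p : Param, param576 (design576 p) = p := by decide

/-- The 576 design matrices are pairwise distinct. [folklore] -/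
theorem design576_injective : Function.Injective design576 := fun p q h => by
  have h' := congrArg param576 h
  rwa [param576_design576, param576_design576] at h'

set_option maxRecDepth 16384 in
/-- Every design matrix has Frobenius norm `4` and non-zero determinant. [folklore] -/
theorem design576_good :
    ∀ p : Param, ip (design576 p) (design576 p) = 4 ∧ det3 (design576 p) ≠ 0 := by
  decide

/-- There are `576 > 512 = 8³` parameters. [folklore] -/
theorem card_param576 : Fintype.card Param = 576 := by simp

/-- `Σ (A − B)² ≥ 1` for distinct integer matrices: `2⟨A,B⟩ + 1 ≤ |A|² + |B|²`. [folklore] -/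
theorem two_ip_succ_le {A B : Fin 3 → Fin 3 → ℤ} (hne : A ≠ B) : 2 * ip A B + 1 ≤ ip A A + ip B B := by
  have hdif : ∑ i, ∑ j, (A i j - B i j) ^ 2 = ip A A + ip B B - 2 * ip A B := by
    simp only [ip, Finset.mul_sum, ← Finset.sum_add_distrib, ← Finset.sum_sub_distrib]
    refine Finset.sum_congr rfl fun i _ => Finset.sum_congr rfl fun j _ => by ring
  obtain ⟨i, hi⟩ := Function.ne_iff.1 hne
  obtain ⟨j, hj⟩ := Function.ne_iff.1 hi
  have hd : A i j - B i j ≠ 0 := sub_ne_zero.2 hj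
  have h1 : 1 ≤ (A i j - B i j) ^ 2 := by
    have habs := Int.one_le_abs hd
    nlinarith [sq_abs (A i j - B i j), abs_nonneg (A i j - B i j)]
  have h2 : (A i j - B i j) ^ 2 ≤ ∑ j', (A i j' - B i j') ^ 2 :=
    Finset.single_le_sum (f := fun j' => (A i j' - B i j') ^ 2) (fun _ _ => sq_nonneg _)
      (Finset.mem_univ j)
  have h3 : ∑ j', (A i j' - B i j') ^ 2 ≤ ∑ i', ∑ j', (A i' j' - B i' j') ^ 2 :=
    Finset.single_le_sum (f := fun i' => ∑ j', (A i' j' - B i' j') ^ 2)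
      (fun _ _ => Finset.sum_nonneg fun _ _ => sq_nonneg _) (Finset.mem_univ i)
  omega

/-- `Σ (A + B)² ≥ 0`: `-(|A|² + |B|²) ≤ 2⟨A,B⟩`. [folklore] -/
theorem neg_le_two_ip (A B : Fin 3 → Fin 3 → ℤ) : -(ip A A + ip B B) ≤ 2 * ip A B := by
  have hsum : ∑ i, ∑ j, (A i j + B i j) ^ 2 = ip A A + ip B B + 2 * ip A B := by
    simp only [ip, Finset.mul_sum, ← Finset.sum_add_distrib]
    refine Finset.sum_congr rfl fun i _ => Finset.sum_congr rfl fun j _ => by ring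
  have hpos : 0 ≤ ∑ i, ∑ j, (A i j + B i j) ^ 2 :=
    Finset.sum_nonneg fun i _ => Finset.sum_nonneg fun j _ => sq_nonneg _
  omega

/-- Distinct integer matrices of norm `4` have Frobenius product in `[-4, 3]`. [folklore] -/
theorem ip_bounds {A B : Fin 3 → Fin 3 → ℤ} (hA : ip A A = 4) (hB : ip B B = 4) (hne : A ≠ B) :
    -4 ≤ ip A B ∧ ip A B ≤ 3 := by
  have h1 := two_ip_succ_le hne
  have h2 := neg_le_two_ip A B
  constructor <;> omega

/-- The separator of the target `A`: `((2⟨A,g⟩ + 1)² − 25)/56`. [folklore] -/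
noncomputable def sepPoly (A : Fin 3 → Fin 3 → ℤ) : MvPolynomial (Fin 3 × Fin 3) ℂ :=
  MvPolynomial.C (1 / 56 : ℂ) *
    ((MvPolynomial.C 2 * lin A + MvPolynomial.C 1) ^ 2 - MvPolynomial.C 25)

/-- The separator is a quadratic polynomial in the nine entries. [folklore] -/
theorem totalDegree_sepPoly (A : Fin 3 → Fin 3 → ℤ) : (sepPoly A).totalDegree ≤ 2 := by
  unfold sepPoly
  refine (MvPolynomial.totalDegree_mul _ _).trans ?_
  rw [MvPolynomial.totalDegree_C, zero_add]
  refine (MvPolynomial.totalDegree_sub _ _).trans (max_le ?_ (by rw [MvPolynomial.totalDegree_C]; omega))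
  refine (MvPolynomial.totalDegree_pow _ _).trans ?_
  have h1 : (MvPolynomial.C 2 * lin A + MvPolynomial.C 1).totalDegree ≤ 1 := by
    refine (MvPolynomial.totalDegree_add _ _).trans (max_le ?_ (by rw [MvPolynomial.totalDegree_C]; omega))
    refine (MvPolynomial.totalDegree_mul _ _).trans ?_
    rw [MvPolynomial.totalDegree_C, zero_add]
    exact totalDegree_lin A
  omega

/-- The value of the separator at an integer point, as a real number. [folklore] -/
noncomputable def sepVal (k : ℤ) : ℝ := ((2 * k + 1) ^ 2 - 25) / 56

/-- Value of the separator of `A` at the integer point `B`: `sepVal ⟨A, B⟩`. [folklore] -/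
theorem eval_sepPoly (A B : Fin 3 → Fin 3 → ℤ) :
    MvPolynomial.eval (fun ij : Fin 3 × Fin 3 => castM B ij.1 ij.2) (sepPoly A) =
      ((sepVal (ip A B) : ℝ) : ℂ) := by
  simp only [sepPoly, map_mul, map_sub, map_pow, map_add, MvPolynomial.eval_C, eval_lin, sepVal]
  push_cast
  ring

/-- At the target (`⟨A, A⟩ = 4`) the separator is exactly `1`. [folklore] -/
theorem sepVal_four : sepVal 4 = 1 := by norm_num [sepVal]

/-- Off target (`⟨A, B⟩ ∈ [-4, 3]`) the separator has modulus `≤ 3/7`. [folklore] -/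
theorem abs_sepVal_le {k : ℤ} (h1 : -4 ≤ k) (h2 : k ≤ 3) : |sepVal k| ≤ 3 / 7 := by
  unfold sepVal
  interval_cases k <;> norm_num [abs_le]

/-- **Fixed tolerance `≥ 3/7`: the 576-point design.** [folklore] -/
theorem designAt_576 {η : ℝ} (hη : 3 / 7 ≤ η) : DesignAt 3 2 576 1 1 η := by
  classical
  set X : Finset (Matrix.GeneralLinearGroup (Fin 3) ℂ) :=
    (Finset.univ : Finset Param).image fun p => toGL (design576 p) with hX
  have hinj : Function.Injective fun p : Param => toGL (design576 p) := fun p q h =>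
    design576_injective (toGL_inj (design576_good p).2 (design576_good q).2 h)
  have hcard : X.card = 576 := by
    rw [hX, Finset.card_image_of_injective _ hinj, Finset.card_univ, card_param576]
  rw [← hcard]
  refine designAt_of_points X fun x₀ hx₀ => ?_
  obtain ⟨p₀, -, rfl⟩ := Finset.mem_image.1 hx₀
  refine ⟨sepPoly (design576 p₀), totalDegree_sepPoly _, fun x hx => ?_⟩
  obtain ⟨p, -, rfl⟩ := Finset.mem_image.1 hx
  have hev : MvPolynomial.eval (fun ij : Fin 3 × Fin 3 =>
      ((toGL (design576 p) : Matrix.GeneralLinearGroup (Fin 3) ℂ) : Matrix (Fin 3) (Fin 3) ℂ) ij.1 ij.2)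
        (sepPoly (design576 p₀)) = ((sepVal (ip (design576 p₀) (design576 p)) : ℝ) : ℂ) := by
    rw [val_toGL (design576_good p).2]
    exact eval_sepPoly _ _
  refine ⟨fun hxx => ?_, fun hxx => ?_⟩
  · have hpp : p = p₀ := hinj hxx
    subst hpp
    rw [hev, (design576_good p).1, sepVal_four]
    simpa using (by linarith : (0 : ℝ) ≤ η)
  · have hpp : design576 p₀ ≠ design576 p := fun h => hxx (by rw [design576_injective h])
    obtain ⟨hlo, hhi⟩ := ip_bounds (design576_good p₀).1 (design576_good p).1 hpp
    rw [hev, Complex.norm_real, Real.norm_eq_abs]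
    exact (abs_sepVal_le hlo hhi).trans hη

/-- The conclusion fails at `(n, s, N) = (3, 2, 576, 1, 1)` whatever the value of `ω > 0`:
`576^{ω/3} > 512^{ω/3} = 8^ω = 64·8^{ω-2} > 55·8^{ω-2}`. [folklore] -/
theorem not_conclusion_576 : ¬ Conclusion 3 2 576 1 1 := by
  unfold Conclusion
  intro h
  set ω := omega ℂ with hω
  have hω2 : (2 : ℝ) ≤ ω := omega_two_le ℂ
  have hωpos : 0 < ω / 3 := by linarith
  have hC : (((2 : ℕ) + 3 ^ 2).choose (3 ^ 2) : ℝ) = 55 := by norm_num [Nat.choose]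
  have hexp : ((3 : ℕ) : ℝ) * ((3 : ℕ) - 1) / 2 * (ω - 2) = 3 * (ω - 2) := by push_cast; ring
  have hR : ((2 : ℕ) : ℝ) ^ (((3 : ℕ) : ℝ) * ((3 : ℕ) - 1) / 2 * (ω - 2)) = (8 : ℝ) ^ (ω - 2) := by
    rw [hexp, Real.rpow_mul (by norm_num : (0 : ℝ) ≤ (2 : ℕ))]
    norm_num
  have hL : (((576 : ℕ) : ℝ) * ((1 : ℕ) : ℝ) * ((1 : ℕ) : ℝ)) = 576 := by norm_num
  rw [hC, hR, hL] at h
  have h512 : (512 : ℝ) ^ (ω / 3) < (576 : ℝ) ^ (ω / 3) :=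
    Real.rpow_lt_rpow (by norm_num) (by norm_num) hωpos
  have h8 : (512 : ℝ) ^ (ω / 3) = (8 : ℝ) ^ ω := by
    rw [show (512 : ℝ) = (8 : ℝ) ^ (3 : ℝ) by norm_num, ← Real.rpow_mul (by norm_num)]
    ring_nf
  have hsplit : (8 : ℝ) ^ ω = 64 * (8 : ℝ) ^ (ω - 2) := by
    rw [show (64 : ℝ) = (8 : ℝ) ^ (2 : ℝ) by norm_num, ← Real.rpow_add (by norm_num)]
    ring_nf
  have hpos : 0 < (8 : ℝ) ^ (ω - 2) := Real.rpow_pos_of_pos (by norm_num) _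
  linarith

/-- The crux asked at ONE tolerance `η` only (a design at tolerance `η` already prices). [folklore] -/
def SeparationDegreeCostFixedTol (η : ℝ) : Prop :=
  ∀ n : ℕ, 3 ≤ n → ∀ s : ℕ, 2 ≤ s → ∀ N₁ N₂ N₃ : ℕ, DesignAt n s N₁ N₂ N₃ η → Conclusion n s N₁ N₂ N₃

/-- The fixed-tolerance variant is a STRENGTHENING of the crux (for any `η > 0`). [folklore] -/
theorem separationDegreeCost_of_fixedTol {η : ℝ} (hη : 0 < η) (h : SeparationDegreeCostFixedTol η) :
    SeparationDegreeCost :=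
  fun n hn s hs N₁ N₂ N₃ hd => h n hn s hs N₁ N₂ N₃ (hd η hη)

/-- **Load-bearing: the limit `η → 0`.**  No single tolerance `η ≥ 3/7` prices designs: the
fixed-tolerance strengthening of `SeparationDegreeCost` is false (`designAt_576`,
`not_conclusion_576`).  Any proof of the crux must use designs at arbitrarily small `η`. [folklore] -/
theorem separationDegreeCost_fixedTol_false {η : ℝ} (hη : 3 / 7 ≤ η) :
    ¬ SeparationDegreeCostFixedTol η :=
  fun h => not_conclusion_576 (h 3 le_rfl 2 le_rfl 576 1 1 (designAt_576 hη))


/-! ## The binomial factor cannot be dropped: 33 exactly separated points -/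

/-- The `0/1` pattern `E`. [folklore] -/
def patB (f : Fin 3 → Fin 3 → Bool) : Fin 3 → Fin 3 → ℤ := fun i j => if f i j then 1 else 0

/-- `I + E`. [folklore] -/
def matB (f : Fin 3 → Fin 3 → Bool) : Fin 3 → Fin 3 → ℤ :=
  fun i j => patB f i j + if i = j then 1 else 0

/-- Overlap of two patterns (number of common ones). [folklore] -/
def ov (f g : Fin 3 → Fin 3 → Bool) : ℤ := ip (patB f) (patB g)

/-- Weight-`2` patterns `E` with `det (I + E) ≠ 0` (33 of the 36). [folklore] -/
def fam2 : Finset (Fin 3 → Fin 3 → Bool) :=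
  Finset.univ.filter fun f => ov f f = 2 ∧ det3 (matB f) ≠ 0

/-- `33` of the `36` weight-two patterns give an invertible `I + E` (by `decide`). [folklore] -/
theorem fam2_card : fam2.card = 33 := by decide

/-- Members of `fam2` are invertible. [folklore] -/
theorem fam2_det {f : Fin 3 → Fin 3 → Bool} (h : f ∈ fam2) : det3 (matB f) ≠ 0 :=
  (Finset.mem_filter.1 h).2.2

/-- Members of `fam2` have weight two. [folklore] -/
theorem fam2_ov_self {f : Fin 3 → Fin 3 → Bool} (h : f ∈ fam2) : ov f f = 2 :=
  (Finset.mem_filter.1 h).2.1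

/-- A pattern is determined by its `0/1` matrix. [folklore] -/
theorem patB_injective : Function.Injective patB := by
  intro f g h
  funext i j
  have := congrFun (congrFun h i) j
  revert this
  unfold patB
  cases f i j <;> cases g i j <;> simp

/-- A pattern is determined by `I + E`. [folklore] -/
theorem matB_injective : Function.Injective matB := by
  intro f g h
  refine patB_injective (funext fun i => funext fun j => ?_)
  have := congrFun (congrFun h i) j
  simpa [matB] using this

/-- Pattern entries are non-negative. [folklore] -/
theorem patB_nonneg (f : Fin 3 → Fin 3 → Bool) (i j : Fin 3) : 0 ≤ patB f i j := by
  unfold patB; split <;> norm_num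

/-- Two distinct weight-`2` patterns overlap in `0` or `1` places. [folklore] -/
theorem fam2_ov_ne {f g : Fin 3 → Fin 3 → Bool} (hf : f ∈ fam2) (hg : g ∈ fam2) (hne : f ≠ g) :
    ov f g = 0 ∨ ov f g = 1 := by
  have hne' : patB f ≠ patB g := fun h => hne (patB_injective h)
  have h1 := two_ip_succ_le hne'
  have h2 : 0 ≤ ov f g := by
    unfold ov ip
    exact Finset.sum_nonneg fun i _ => Finset.sum_nonneg fun j _ =>
      mul_nonneg (patB_nonneg f i j) (patB_nonneg g i j)
  have hff := fam2_ov_self hf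
  have hgg := fam2_ov_self hg
  unfold ov at *
  omega

/-- The exact separator of the target `I + E₀`: `u(u-1)/2`, `u(g) = Σ_{E₀(ij)=1} (g_{ij} − δ_{ij})`.
[folklore] -/
noncomputable def linB (f : Fin 3 → Fin 3 → Bool) : MvPolynomial (Fin 3 × Fin 3) ℂ :=
  ∑ i, ∑ j, MvPolynomial.C (patB f i j : ℂ) *
    (MvPolynomial.X (i, j) - MvPolynomial.C (if i = j then (1 : ℂ) else 0))

/-- The exact separator `u(u-1)/2` of the target pattern. [folklore] -/
noncomputable def sepB (f : Fin 3 → Fin 3 → Bool) : MvPolynomial (Fin 3 × Fin 3) ℂ :=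
  MvPolynomial.C (1 / 2 : ℂ) * (linB f * (linB f - MvPolynomial.C 1))

/-- `u` has total degree `≤ 1`. [folklore] -/
theorem totalDegree_linB (f : Fin 3 → Fin 3 → Bool) : (linB f).totalDegree ≤ 1 := by
  unfold linB
  refine (MvPolynomial.totalDegree_finsetSum _ _).trans (Finset.sup_le fun i _ => ?_)
  refine (MvPolynomial.totalDegree_finsetSum _ _).trans (Finset.sup_le fun j _ => ?_)
  refine (MvPolynomial.totalDegree_mul _ _).trans ?_
  rw [MvPolynomial.totalDegree_C, zero_add]
  refine (MvPolynomial.totalDegree_sub _ _).trans (max_le ?_ ?_)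
  · rw [MvPolynomial.totalDegree_X]
  · rw [MvPolynomial.totalDegree_C]; omega

/-- The exact separator is quadratic. [folklore] -/
theorem totalDegree_sepB (f : Fin 3 → Fin 3 → Bool) : (sepB f).totalDegree ≤ 2 := by
  unfold sepB
  refine (MvPolynomial.totalDegree_mul _ _).trans ?_
  rw [MvPolynomial.totalDegree_C, zero_add]
  refine (MvPolynomial.totalDegree_mul _ _).trans ?_
  have h1 := totalDegree_linB f
  have h2 : (linB f - MvPolynomial.C 1).totalDegree ≤ 1 :=
    (MvPolynomial.totalDegree_sub _ _).trans (max_le h1 (by rw [MvPolynomial.totalDegree_C]; omega))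
  omega

/-- `u_{E₀}(I + E) = ⟨E₀, E⟩`, the overlap. [folklore] -/
theorem eval_linB (f g : Fin 3 → Fin 3 → Bool) :
    MvPolynomial.eval (fun ij : Fin 3 × Fin 3 => castM (matB g) ij.1 ij.2) (linB f) = (ov f g : ℂ) := by
  simp only [linB, ov, ip, castM, matB, map_sum, map_mul, map_sub, MvPolynomial.eval_C,
    MvPolynomial.eval_X, Matrix.of_apply]
  push_cast
  refine Finset.sum_congr rfl fun i _ => Finset.sum_congr rfl fun j _ => by ring

/-- The separator of `E₀` at `I + E` is `⟨E₀,E⟩(⟨E₀,E⟩ − 1)/2`. [folklore] -/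
theorem eval_sepB (f g : Fin 3 → Fin 3 → Bool) :
    MvPolynomial.eval (fun ij : Fin 3 × Fin 3 => castM (matB g) ij.1 ij.2) (sepB f) =
      (1 / 2 : ℂ) * ((ov f g : ℂ) * ((ov f g : ℂ) - 1)) := by
  simp only [sepB, map_mul, map_sub, MvPolynomial.eval_C, eval_linB]

/-- **The 33-point design, exactly separated in degree 2, at every tolerance.** [folklore] -/
theorem designAt_33 {η : ℝ} (hη : 0 ≤ η) : DesignAt 3 2 33 1 1 η := by
  classical
  set X : Finset (Matrix.GeneralLinearGroup (Fin 3) ℂ) := fam2.image fun f => toGL (matB f) with hX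
  have hinj : Set.InjOn (fun f => toGL (matB f)) (fam2 : Set (Fin 3 → Fin 3 → Bool)) := by
    intro f hf g hg h
    exact matB_injective (toGL_inj (fam2_det hf) (fam2_det hg) h)
  have hcard : X.card = 33 := by rw [hX, Finset.card_image_of_injOn hinj, fam2_card]
  rw [← hcard]
  refine designAt_of_points X fun x₀ hx₀ => ?_
  obtain ⟨f₀, hf₀, rfl⟩ := Finset.mem_image.1 hx₀
  refine ⟨sepB f₀, totalDegree_sepB _, fun x hx => ?_⟩
  obtain ⟨f, hf, rfl⟩ := Finset.mem_image.1 hx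
  have hev : MvPolynomial.eval (fun ij : Fin 3 × Fin 3 =>
      ((toGL (matB f) : Matrix.GeneralLinearGroup (Fin 3) ℂ) : Matrix (Fin 3) (Fin 3) ℂ) ij.1 ij.2)
        (sepB f₀) = (1 / 2 : ℂ) * ((ov f₀ f : ℂ) * ((ov f₀ f : ℂ) - 1)) := by
    rw [val_toGL (fam2_det hf)]
    exact eval_sepB _ _
  refine ⟨fun hxx => ?_, fun hxx => ?_⟩
  · have hff : f = f₀ := hinj hf hf₀ hxx
    subst hff
    rw [hev, fam2_ov_self hf]
    norm_num [hη]
  · have hff : f₀ ≠ f := fun h => hxx (by rw [h])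
    rcases fam2_ov_ne hf₀ hf hff with h0 | h1
    · rw [hev, h0]; norm_num [hη]
    · rw [hev, h1]; norm_num [hη]

/-- Deleting the binomial factor `C(s+n², n²) ≥ 1` from the bound is a STRENGTHENING of the crux
(the strengthened statement is written out: a parameterless `def … : Prop` would be a named fact).
[folklore] -/
theorem separationDegreeCost_of_noBinomial
    (h : ∀ n : ℕ, 3 ≤ n → ∀ s : ℕ, 2 ≤ s → ∀ N₁ N₂ N₃ : ℕ,
      (∀ η : ℝ, 0 < η → DesignAt n s N₁ N₂ N₃ η) →
        ((N₁ : ℝ) * N₂ * N₃) ^ (omega ℂ / 3) ≤ (s : ℝ) ^ ((n : ℝ) * (n - 1) / 2 * (omega ℂ - 2))) :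
    SeparationDegreeCost := by
  intro n hn s hs N₁ N₂ N₃ hd
  have h1 := h n hn s hs N₁ N₂ N₃ hd
  have hC : (1 : ℝ) ≤ ((s + n ^ 2).choose (n ^ 2) : ℝ) := by
    exact_mod_cast Nat.choose_pos (Nat.le_add_left _ _)
  have hpow : 0 ≤ (s : ℝ) ^ ((n : ℝ) * (n - 1) / 2 * (omega ℂ - 2)) :=
    Real.rpow_nonneg (Nat.cast_nonneg s) _
  calc ((N₁ : ℝ) * N₂ * N₃) ^ (omega ℂ / 3)
      ≤ (s : ℝ) ^ ((n : ℝ) * (n - 1) / 2 * (omega ℂ - 2)) := h1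
    _ = (s : ℝ) ^ ((n : ℝ) * (n - 1) / 2 * (omega ℂ - 2)) * 1 := (mul_one _).symm
    _ ≤ (s : ℝ) ^ ((n : ℝ) * (n - 1) / 2 * (omega ℂ - 2)) * ((s + n ^ 2).choose (n ^ 2) : ℝ) :=
        mul_le_mul_of_nonneg_left hC hpow

/-- **The binomial factor is load-bearing**: `33^{ω/3} ≥ 33^{2/3} > 8 ≥ 8^{ω−2}` at the exactly
separated 33-point design (`designAt_33`), using only `2 ≤ ω ≤ 3`. [folklore] -/
theorem separationDegreeCost_noBinomial_false :
    ¬ ∀ n : ℕ, 3 ≤ n → ∀ s : ℕ, 2 ≤ s → ∀ N₁ N₂ N₃ : ℕ,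
      (∀ η : ℝ, 0 < η → DesignAt n s N₁ N₂ N₃ η) →
        ((N₁ : ℝ) * N₂ * N₃) ^ (omega ℂ / 3) ≤ (s : ℝ) ^ ((n : ℝ) * (n - 1) / 2 * (omega ℂ - 2)) := by
  intro h
  have h1 := h 3 le_rfl 2 le_rfl 33 1 1 fun η hη => designAt_33 hη.le
  set ω := omega ℂ with hω
  have hω2 : (2 : ℝ) ≤ ω := omega_two_le ℂ
  have hω3 : ω ≤ 3 := omega_le_three' ℂ
  have hexp : ((3 : ℕ) : ℝ) * ((3 : ℕ) - 1) / 2 * (ω - 2) = 3 * (ω - 2) := by push_cast; ring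
  have hR : ((2 : ℕ) : ℝ) ^ (((3 : ℕ) : ℝ) * ((3 : ℕ) - 1) / 2 * (ω - 2)) = (8 : ℝ) ^ (ω - 2) := by
    rw [hexp, Real.rpow_mul (by norm_num : (0 : ℝ) ≤ (2 : ℕ))]
    norm_num
  have hL : (((33 : ℕ) : ℝ) * ((1 : ℕ) : ℝ) * ((1 : ℕ) : ℝ)) = 33 := by norm_num
  rw [hR, hL] at h1
  -- 8^(ω-2) ≤ 8
  have hR8 : (8 : ℝ) ^ (ω - 2) ≤ 8 := by
    have := Real.rpow_le_rpow_of_exponent_le (by norm_num : (1 : ℝ) ≤ 8) (by linarith : ω - 2 ≤ 1)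
    rwa [Real.rpow_one] at this
  -- 33^(2/3) ≤ 33^(ω/3)
  have hL33 : (33 : ℝ) ^ ((2 : ℝ) / 3) ≤ (33 : ℝ) ^ (ω / 3) :=
    Real.rpow_le_rpow_of_exponent_le (by norm_num) (by linarith)
  -- 8 < 33^(2/3) since 8^3 = 512 < 1089 = 33^2
  have h8 : (8 : ℝ) < (33 : ℝ) ^ ((2 : ℝ) / 3) := by
    by_contra hle
    have hle : (33 : ℝ) ^ ((2 : ℝ) / 3) ≤ 8 := le_of_not_gt hle
    have hnn : 0 ≤ (33 : ℝ) ^ ((2 : ℝ) / 3) := Real.rpow_nonneg (by norm_num) _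
    have h3 : ((33 : ℝ) ^ ((2 : ℝ) / 3)) ^ (3 : ℝ) ≤ (8 : ℝ) ^ (3 : ℝ) :=
      Real.rpow_le_rpow hnn hle (by norm_num)
    rw [← Real.rpow_mul (by norm_num)] at h3
    norm_num at h3
  linarith

/-! ## The clause `2 ≤ s`: deleting it makes the crux imply `ω = 2` through `0 ^ 0 = 1` -/

/-- Deleting the clause `2 ≤ s` is a STRENGTHENING of the crux (statement written out). [folklore] -/
theorem separationDegreeCost_of_anyDegree
    (h : ∀ n : ℕ, 3 ≤ n → ∀ s : ℕ, ∀ N₁ N₂ N₃ : ℕ, (∀ η : ℝ, 0 < η → DesignAt n s N₁ N₂ N₃ η) →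
      Conclusion n s N₁ N₂ N₃) :
    SeparationDegreeCost :=
  fun n hn s _ N₁ N₂ N₃ hd => h n hn s N₁ N₂ N₃ hd

/-- **Junk-exponent hazard.** Without `2 ≤ s`, the instance `s = 0`, `X = Y = Z = {1}`, `p = 1` reads
`1 ≤ 0^{3(ω−2)} · 1`, which holds iff `ω = 2` (real `0 ^ 0 = 1`, `0 ^ t = 0` for `t ≠ 0`).  So the
deleted variant implies `ω(ℂ) = 2`: a proof of the crux must use `1 ≤ s` somewhere. [folklore] -/
theorem omega_eq_two_of_separationDegreeCost_anyDegree
    (h : ∀ n : ℕ, 3 ≤ n → ∀ s : ℕ, ∀ N₁ N₂ N₃ : ℕ, (∀ η : ℝ, 0 < η → DesignAt n s N₁ N₂ N₃ η) →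
      Conclusion n s N₁ N₂ N₃) :
    omega ℂ = 2 := by
  have h1 := h 3 le_rfl 0 1 1 1 fun η hη => designAt_one 3 0 hη.le
  unfold Conclusion at h1
  by_contra hne
  have hω2 : (2 : ℝ) ≤ omega ℂ := omega_two_le ℂ
  have hexp : ((3 : ℕ) : ℝ) * ((3 : ℕ) - 1) / 2 * (omega ℂ - 2) ≠ 0 := by
    push_cast
    intro h0
    apply hne
    nlinarith
  rw [Nat.cast_zero, Real.zero_rpow hexp, zero_mul] at h1
  have : (0 : ℝ) < (((1 : ℕ) : ℝ) * ((1 : ℕ) : ℝ) * ((1 : ℕ) : ℝ)) ^ (omega ℂ / 3) := by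
    norm_num
  linarith


/-! ## The degree bound: the same 576 points are EXACTLY separated in degree `575` -/

/-- The exact (Lagrange-type) separator of the target `x₀ = design576 p₀` WITHOUT degree bound:
`Π_{x ≠ x₀} (4 − ⟨x, g⟩)/(4 − ⟨x, x₀⟩)` (well defined since `⟨x, x₀⟩ ≤ 3 < 4 = ⟨x, x⟩`). [folklore] -/
noncomputable def lagrange576 (p₀ : Param) : MvPolynomial (Fin 3 × Fin 3) ℂ :=
  ∏ p ∈ (Finset.univ : Finset Param).erase p₀,
    MvPolynomial.C ((4 - (ip (design576 p) (design576 p₀) : ℂ))⁻¹) *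
      (MvPolynomial.C 4 - lin (design576 p))

/-- Value of the exact separator at a design point: `1` at the target, `0` elsewhere. [folklore] -/
theorem eval_lagrange576 (p₀ q : Param) :
    MvPolynomial.eval (fun ij : Fin 3 × Fin 3 => castM (design576 q) ij.1 ij.2) (lagrange576 p₀) =
      if q = p₀ then 1 else 0 := by
  unfold lagrange576
  rw [map_prod]
  simp only [map_mul, map_sub, MvPolynomial.eval_C, eval_lin]
  split_ifs with hq
  · subst hq
    refine Finset.prod_eq_one fun p hp => ?_
    have hne : design576 p ≠ design576 q := fun h => (Finset.mem_erase.1 hp).1 (design576_injective h)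
    have h3 := (ip_bounds (design576_good p).1 (design576_good q).1 hne).2
    have h4 : (4 : ℂ) - (ip (design576 p) (design576 q) : ℂ) ≠ 0 := by
      have : ((4 - ip (design576 p) (design576 q) : ℤ) : ℂ) ≠ 0 := by exact_mod_cast (by omega)
      push_cast at this
      exact this
    exact inv_mul_cancel₀ h4
  · refine Finset.prod_eq_zero (Finset.mem_erase.2 ⟨hq, Finset.mem_univ q⟩) ?_
    rw [(design576_good q).1]
    push_cast
    ring

/-- The design clause with the degree bound `p.totalDegree ≤ s` DELETED. [folklore] -/
def DesignAtNoDegree (n N₁ N₂ N₃ : ℕ) (η : ℝ) : Prop :=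
  ∃ X Y Z : Finset (Matrix.GeneralLinearGroup (Fin n) ℂ), N₁ ≤ X.card ∧ N₂ ≤ Y.card ∧ N₃ ≤ Z.card ∧ (∀ x ∈ X, ∀ x' ∈ X, ∀ y ∈ Y, ∀ y' ∈ Y, ∀ z ∈ Z, ∀ z' ∈ Z, x * y⁻¹ * y' * z⁻¹ = x' * z'⁻¹ → x = x' ∧ y = y' ∧ z = z') ∧ ∀ x₀ ∈ X, ∀ z₀ ∈ Z, ∃ p : MvPolynomial (Fin n × Fin n) ℂ, ∀ x ∈ X, ∀ y ∈ Y, ∀ y' ∈ Y, ∀ z ∈ Z, ((x = x₀ ∧ y = y' ∧ z = z₀) → ‖MvPolynomial.eval (fun ij : Fin n × Fin n => ((x * y⁻¹ * y' * z⁻¹ : Matrix.GeneralLinearGroup (Fin n) ℂ) : Matrix (Fin n) (Fin n) ℂ) ij.1 ij.2) p - 1‖ ≤ η) ∧ (¬ (x = x₀ ∧ y = y' ∧ z = z₀) → ‖MvPolynomial.eval (fun ij : Fin n × Fin n => ((x * y⁻¹ * y' * z⁻¹ : Matrix.GeneralLinearGroup (Fin n) ℂ) : Matrix (Fin n) (Fin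 n) ℂ) ij.1 ij.2) p‖ ≤ η)

/-- Forgetting the degree bound: `DesignAt n s N η → DesignAtNoDegree n N η`, and conversely a design
without degree bound is a design at degree `s` for SOME `s`. [folklore] -/
theorem designAtNoDegree_iff (n N₁ N₂ N₃ : ℕ) (η : ℝ) :
    DesignAtNoDegree n N₁ N₂ N₃ η ↔ ∃ s, DesignAt n s N₁ N₂ N₃ η := by
  classical
  constructor
  · rintro ⟨X, Y, Z, hX, hY, hZ, htpp, hsep⟩
    choose p hp using hsep
    refine ⟨X.attach.sup fun x => Z.attach.sup fun z => (p x.1 x.2 z.1 z.2).totalDegree,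
      X, Y, Z, hX, hY, hZ, htpp, fun x₀ hx₀ z₀ hz₀ => ⟨p x₀ hx₀ z₀ hz₀, ?_, hp x₀ hx₀ z₀ hz₀⟩⟩
    have h1 : (p x₀ hx₀ z₀ hz₀).totalDegree ≤
        (Z.attach.sup fun z => (p x₀ hx₀ z.1 z.2).totalDegree) :=
      Finset.le_sup (f := fun z : {z // z ∈ Z} => (p x₀ hx₀ z.1 z.2).totalDegree)
        (Finset.mem_attach Z ⟨z₀, hz₀⟩)
    exact h1.trans (Finset.le_sup
      (f := fun x : {x // x ∈ X} => Z.attach.sup fun z => (p x.1 x.2 z.1 z.2).totalDegree)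
      (Finset.mem_attach X ⟨x₀, hx₀⟩))
  · rintro ⟨s, X, Y, Z, hX, hY, hZ, htpp, hsep⟩
    exact ⟨X, Y, Z, hX, hY, hZ, htpp, fun x₀ hx₀ z₀ hz₀ =>
      let ⟨p, _, hp⟩ := hsep x₀ hx₀ z₀ hz₀; ⟨p, hp⟩⟩

/-- **The 576 points, exactly separated (degree 575), at every tolerance.** [folklore] -/
theorem designAtNoDegree_576 {η : ℝ} (hη : 0 ≤ η) : DesignAtNoDegree 3 576 1 1 η := by
  classical
  rw [designAtNoDegree_iff]
  refine ⟨(lagrange576 default).totalDegree ⊔ Finset.univ.sup fun p₀ => (lagrange576 p₀).totalDegree, ?_⟩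
  set X : Finset (Matrix.GeneralLinearGroup (Fin 3) ℂ) :=
    (Finset.univ : Finset Param).image fun p => toGL (design576 p) with hX
  have hinj : Function.Injective fun p : Param => toGL (design576 p) := fun p q h =>
    design576_injective (toGL_inj (design576_good p).2 (design576_good q).2 h)
  have hcard : X.card = 576 := by
    rw [hX, Finset.card_image_of_injective _ hinj, Finset.card_univ, card_param576]
  rw [← hcard]
  refine designAt_of_points X fun x₀ hx₀ => ?_
  obtain ⟨p₀, -, rfl⟩ := Finset.mem_image.1 hx₀
  refine ⟨lagrange576 p₀, le_sup_of_le_right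
    (Finset.le_sup (f := fun q => (lagrange576 q).totalDegree) (Finset.mem_univ p₀)), fun x hx => ?_⟩
  obtain ⟨p, -, rfl⟩ := Finset.mem_image.1 hx
  rw [val_toGL (design576_good p).2, eval_lagrange576]
  refine ⟨fun hxx => ?_, fun hxx => ?_⟩
  · rw [if_pos (hinj hxx)]; simp [hη]
  · rw [if_neg fun h => hxx (by rw [h])]; simp [hη]

/-- Deleting the degree bound is a STRENGTHENING of the crux (statement written out). [folklore] -/
theorem separationDegreeCost_of_noDegreeBound
    (h : ∀ n : ℕ, 3 ≤ n → ∀ s : ℕ, 2 ≤ s → ∀ N₁ N₂ N₃ : ℕ,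
      (∀ η : ℝ, 0 < η → DesignAtNoDegree n N₁ N₂ N₃ η) → Conclusion n s N₁ N₂ N₃) :
    SeparationDegreeCost :=
  fun n hn s hs N₁ N₂ N₃ hd => h n hn s hs N₁ N₂ N₃ fun η hη =>
    (designAtNoDegree_iff n N₁ N₂ N₃ η).2 ⟨s, hd η hη⟩

/-- **The degree bound is load-bearing**: every finite point set in `GL₃(ℂ)` is exactly separated by
polynomials of SOME degree (here the 576 design points, degree `575`), so without `p.totalDegree ≤ s`
the bound at `s = 2` fails (`not_conclusion_576`).  Contrast: the same points are only
`3/7`-separated in degree `2` (`designAt_576`). [folklore] -/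
theorem separationDegreeCost_noDegreeBound_false :
    ¬ ∀ n : ℕ, 3 ≤ n → ∀ s : ℕ, 2 ≤ s → ∀ N₁ N₂ N₃ : ℕ,
      (∀ η : ℝ, 0 < η → DesignAtNoDegree n N₁ N₂ N₃ η) → Conclusion n s N₁ N₂ N₃ :=
  fun h => not_conclusion_576 (h 3 le_rfl 2 le_rfl 576 1 1 fun _ hη => designAtNoDegree_576 hη.le)

/-! ## The cross terms `y ≠ y'`: without them `Y` is unconstrained -/

/-- The design clause with the separator constrained only on tuples with `y' = y` (no cross terms).
[folklore] -/
def DesignAtNoCross (n s N₁ N₂ N₃ : ℕ) (η : ℝ) : Prop :=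
  ∃ X Y Z : Finset (Matrix.GeneralLinearGroup (Fin n) ℂ), N₁ ≤ X.card ∧ N₂ ≤ Y.card ∧ N₃ ≤ Z.card ∧ (∀ x ∈ X, ∀ x' ∈ X, ∀ y ∈ Y, ∀ y' ∈ Y, ∀ z ∈ Z, ∀ z' ∈ Z, x * y⁻¹ * y' * z⁻¹ = x' * z'⁻¹ → x = x' ∧ y = y' ∧ z = z') ∧ ∀ x₀ ∈ X, ∀ z₀ ∈ Z, ∃ p : MvPolynomial (Fin n × Fin n) ℂ, p.totalDegree ≤ s ∧ ∀ x ∈ X, ∀ y ∈ Y, ∀ z ∈ Z, ((x = x₀ ∧ z = z₀) → ‖MvPolynomial.eval (fun ij : Fin n × Fin n => ((x * y⁻¹ * y * z⁻¹ : Matrix.GeneralLinearGroup (Fin n) ℂ) : Matrix (Fin n) (Fin n) ℂ) ij.1 ij.2) p - 1‖ ≤ η) ∧ (¬ (x = x₀ ∧ z = z₀) → ‖MvPolynomial.eval (fun ij : Fin n × Fin n => ((x * y⁻¹ * y * z⁻¹ : Matrix.GeneralLinearGroup (Fin n) ℂ) : Matrix (Fin n) (Fin n) ℂ) ij.1 ij.2)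 p‖ ≤ η)

/-- Forgetting the cross terms: specialise the separator clause to `y' = y`. [folklore] -/
theorem designAtNoCross_of_designAt {n s N₁ N₂ N₃ : ℕ} {η : ℝ} (h : DesignAt n s N₁ N₂ N₃ η) :
    DesignAtNoCross n s N₁ N₂ N₃ η := by
  obtain ⟨X, Y, Z, hX, hY, hZ, htpp, hsep⟩ := h
  refine ⟨X, Y, Z, hX, hY, hZ, htpp, fun x₀ hx₀ z₀ hz₀ => ?_⟩
  obtain ⟨p, hp, hsep⟩ := hsep x₀ hx₀ z₀ hz₀
  refine ⟨p, hp, fun x hx y hy z hz => ?_⟩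
  obtain ⟨h1, h0⟩ := hsep x hx y hy y hy z hz
  exact ⟨fun hh => h1 ⟨hh.1, rfl, hh.2⟩, fun hh => h0 fun hh' => hh ⟨hh'.1, hh'.2.2⟩⟩

/-- **Without cross terms `Y` is free**: `X = Z = {1}`, `Y` = the 576 design points, `p = 1`. [folklore] -/
theorem designAtNoCross_576 (s : ℕ) {η : ℝ} (hη : 0 ≤ η) : DesignAtNoCross 3 s 1 576 1 η := by
  classical
  set Y : Finset (Matrix.GeneralLinearGroup (Fin 3) ℂ) :=
    (Finset.univ : Finset Param).image fun p => toGL (design576 p) with hY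
  have hinj : Function.Injective fun p : Param => toGL (design576 p) := fun p q h =>
    design576_injective (toGL_inj (design576_good p).2 (design576_good q).2 h)
  have hcard : Y.card = 576 := by
    rw [hY, Finset.card_image_of_injective _ hinj, Finset.card_univ, card_param576]
  refine ⟨{1}, Y, {1}, by simp, hcard.ge, by simp, ?_, ?_⟩
  · intro x hx x' hx' y _ y' _ z hz z' hz' h
    simp only [Finset.mem_singleton] at hx hx' hz hz'
    subst hx hx' hz hz'
    have h' : y⁻¹ * y' = 1 := by simpa using h
    exact ⟨rfl, inv_mul_eq_one.1 h', rfl⟩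
  · intro x₀ hx₀ z₀ hz₀
    refine ⟨1, by simp, fun x hx y _ z hz => ?_⟩
    simp only [Finset.mem_singleton] at hx hx₀ hz hz₀
    subst hx hx₀ hz hz₀
    exact ⟨fun _ => by simp [hη], fun hh => (hh ⟨rfl, rfl⟩).elim⟩

/-- Deleting the cross terms is a STRENGTHENING of the crux (statement written out). [folklore] -/
theorem separationDegreeCost_of_noCross
    (h : ∀ n : ℕ, 3 ≤ n → ∀ s : ℕ, 2 ≤ s → ∀ N₁ N₂ N₃ : ℕ,
      (∀ η : ℝ, 0 < η → DesignAtNoCross n s N₁ N₂ N₃ η) → Conclusion n s N₁ N₂ N₃) :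
    SeparationDegreeCost :=
  fun n hn s hs N₁ N₂ N₃ hd => h n hn s hs N₁ N₂ N₃ fun η hη => designAtNoCross_of_designAt (hd η hη)

/-- The conclusion is symmetric in `N`: `(3, 2, 1, 576, 1)` fails like `(3, 2, 576, 1, 1)`. [folklore] -/
theorem not_conclusion_1_576_1 : ¬ Conclusion 3 2 1 576 1 := by
  intro h
  apply not_conclusion_576
  unfold Conclusion at h ⊢
  have e : ((576 : ℕ) : ℝ) * ((1 : ℕ) : ℝ) * ((1 : ℕ) : ℝ) = ((1 : ℕ) : ℝ) * ((576 : ℕ) : ℝ) * ((1 : ℕ) : ℝ) := by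
    push_cast; ring
  rw [e]
  exact h

/-- **The cross terms are load-bearing**: the vanishing of the separators at `x y⁻¹ y' z⁻¹`, `y ≠ y'`,
is exactly what makes `|Y|` enter the price; without it `N₂` is unbounded at fixed `(n, s)`. [folklore] -/
theorem separationDegreeCost_noCross_false :
    ¬ ∀ n : ℕ, 3 ≤ n → ∀ s : ℕ, 2 ≤ s → ∀ N₁ N₂ N₃ : ℕ,
      (∀ η : ℝ, 0 < η → DesignAtNoCross n s N₁ N₂ N₃ η) → Conclusion n s N₁ N₂ N₃ :=
  fun h => not_conclusion_1_576_1 (h 3 le_rfl 2 le_rfl 1 576 1 fun _ hη => designAtNoCross_576 2 hη.le)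

end Neg

end Summit.MatrixMultiplication.MatrixMultiplication.Cruxes.SeparationDegreeCost.Disproof

end
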